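import Summits.Ventures.Crystal3D.Theorems.StickyWulffConstantCoaxialWallLawInPlaneStackWalkersTwin
import Summits.Ventures.Crystal3D.Theorems.StickyWulffConstantGenericWallFloorAtHalfWide
import HarnessLib

/-!
# Lane F's cell inequality at charge `½ sin θ` for every twin pair with `(√3/2) sin θ ≥ 9/20` (WIDE tilt), arbitrary fillings
# (crux `CoaxialWallLaw`, stmt-Ventures-19481, line `WallLedgerF`; in-plane stack walkers of lane G)

HONEST FRAMING. Venture `Summits/Ventures/Crystal3D` (cell `crystal3d-full`), helper `--supports` the crux `CoaxialWallLaw`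
of `route-Ventures-StickyWulffConstant` (registered line `WallLedgerF`, open stub `stub_coaxialTwoSlabAdhesion`).  Rung credit
only; F-C1 not moved; NOT the stub: translation pairs and twins with `sin θ < 9/(10√3) ≈ 0.52` remain, and `ExactOnly`(C12-55),
`StarPairFar` are inputs BY NAME.
`…CoaxialWallLawInPlaneStackWalkersTwin` (19480-p1 g7) with the WIDE tilt `‖z − e₃‖ ≤ 1/3` of
`twoSlabAdhesion_stackLedger_oneSided_wide`: the threshold on the twin plane drops from `(√3/2) sin θ ≥ 13/25` (`sin θ ≥ 0.60`,
`80 %` of Haar twin orientations) to `(√3/2) sin θ ≥ 9/20` (`sin θ ≥ 0.52`, `85 %`):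
* `twoSlabLedger_twin_inPlane_wide_of_inner_ge` — twin pair, in-plane slot with `⟪A₁d, e₃⟫ ≥ 9/20`: `TwoSlabLedgerAt ((√2/2)⟪A₁d,e₃⟫)`;
* **`coaxialTwin_twoSlabLedger_half_sin_wide`** — co-axial pair with different linear lattices ⇒ twin about `ν`, and
  `(√3/2)√(1−⟪ν,e₃⟫²) ≥ 9/20 ⇒ TwoSlabLedgerAt (½·√(1−⟪ν,e₃⟫²))` (indeed `(√6/4)·`, `…_sharp_wide`).
WHAT THIS IS NOT: not `stub_coaxialTwoSlabAdhesion`; F-C1 not moved.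
-/

noncomputable section

namespace Summit.Ventures.Crystal3D.Theorems

open Summit.Ventures.Crystal3D Finset
open Literature.MathematicalPhysics.StatisticalMechanics (fccStacking barlowStacking IsHaggSeq contactDeficiency)
open scoped InnerProductSpace

open scoped Classical in
/-- **Twin pair, ANY in-plane slot of grain 1 with `e₃`-component `≥ 9/20`** (wide tilt): the clamped-cell inequality at charge
`(√2/2)⟪A₁d₁, e₃⟫`, arbitrary fillings, modulo `ExactOnly`(C12-55) and `StarPairFar`. -/
theorem twoSlabLedger_twin_inPlane_wide_of_inner_ge
    {s₀ : EuclideanSpace ℝ (Fin 3)} (hs₀ : s₀ ∈ fccSlots)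
    (hcert : ExactOnly 0 (fccSlots.filter fun w => 0 < ⟪w, s₀⟫_ℝ)) (hfar : StarPairFar)
    (A₁ : EuclideanSpace ℝ (Fin 3) ≃ₗᵢ[ℝ] EuclideanSpace ℝ (Fin 3)) (t₁ : EuclideanSpace ℝ (Fin 3))
    (A₂ : EuclideanSpace ℝ (Fin 3) ≃ₗᵢ[ℝ] EuclideanSpace ℝ (Fin 3)) (t₂ : EuclideanSpace ℝ (Fin 3))
    {μ : EuclideanSpace ℝ (Fin 3)}
    (hμ : ‖μ‖ = 1 ∧ ∀ w ∈ fccSlots, ⟪w, μ⟫_ℝ = 0 ∨ ⟪w, μ⟫_ℝ = Real.sqrt (2 / 3) ∨ ⟪w, μ⟫_ℝ = -Real.sqrt (2 / 3))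
    (hA₂ : A₂ '' fccStacking 1 (Real.sqrt (2 / 3)) = (wordFrame A₁ [μ]) '' fccStacking 1 (Real.sqrt (2 / 3)))
    {d₁ : EuclideanSpace ℝ (Fin 3)} (hd₁ : d₁ ∈ fccSlots) (hplane : ⟪d₁, μ⟫_ℝ = 0)
    (hup : (9 / 20 : ℝ) ≤ ⟪A₁ d₁, EuclideanSpace.single (2 : Fin 3) (1 : ℝ)⟫_ℝ) :
    TwoSlabLedgerAt (Real.sqrt 2 * ⟪A₁ d₁, EuclideanSpace.single (2 : Fin 3) (1 : ℝ)⟫_ℝ / 2) A₁ t₁ A₂ t₂ := by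
  obtain ⟨z, hz, hze, hsteep⟩ := exists_tilt_vertical_wide
    (by rw [LinearIsometryEquiv.norm_map, norm_eq_one_of_mem_fccSlots hd₁]) hup
  have h := twoSlabAdhesion_stackLedger_oneSided_wide hs₀ hcert (doubleStarCoaxialAt_of_starPairFar hfar)
    (capPairCoaxial_of_starPairFar hfar) A₁ t₁ A₂ t₂ hz hze hd₁ hsteep
    {F | ∃ stk : List WalkEntry, StackSound z stk ∧ StackWF z stk ∧ stk.getLast? = some ⟨A₁, d₁, 0⟩ ∧
      ∃ e ∈ stk, e.frame = F}
    (fun stk hS hW hlast e he => ⟨stk, hS, hW, hlast, e, he, rfl⟩)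
    (fun _ ⟨_, hS, hW, hl, _, he, hF⟩ => by
      rw [← hF, hA₂]; exact image_ne_twin_of_inPlane_stack hμ hplane hS hW hl he)
  have h' : TwoSlabLedgerAt (Real.sqrt 2 * |⟪A₁ d₁, EuclideanSpace.single (2 : Fin 3) (1 : ℝ)⟫_ℝ| / 2) A₁ t₁ A₂ t₂ := h
  rwa [abs_of_nonneg (by linarith : (0 : ℝ) ≤ ⟪A₁ d₁, EuclideanSpace.single (2 : Fin 3) (1 : ℝ)⟫_ℝ)] at h'

open scoped Classical in
/-- **Twin pairs in lane F's terms, wide tilt, sharp charge**: co-axial pair with DIFFERENT linear lattices ⇒ twin about a unit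
menu normal `ν` of grain 1, and `(√3/2)·√(1 − ⟪ν,e₃⟫²) ≥ 9/20 ⇒ TwoSlabLedgerAt ((√6/4)·√(1 − ⟪ν,e₃⟫²))`, arbitrary fillings,
modulo `ExactOnly`(C12-55) and `StarPairFar`. -/
theorem coaxialTwin_twoSlabLedger_sharp_wide
    {s₀ : EuclideanSpace ℝ (Fin 3)} (hs₀ : s₀ ∈ fccSlots)
    (hcert : ExactOnly 0 (fccSlots.filter fun w => 0 < ⟪w, s₀⟫_ℝ)) (hfar : StarPairFar)
    (A₁ : EuclideanSpace ℝ (Fin 3) ≃ₗᵢ[ℝ] EuclideanSpace ℝ (Fin 3)) (t₁ : EuclideanSpace ℝ (Fin 3))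
    (A₂ : EuclideanSpace ℝ (Fin 3) ≃ₗᵢ[ℝ] EuclideanSpace ℝ (Fin 3)) (t₂ : EuclideanSpace ℝ (Fin 3))
    (hco : ∃ (L : EuclideanSpace ℝ (Fin 3) ≃ₗᵢ[ℝ] EuclideanSpace ℝ (Fin 3))
        (s₁ s₂ : EuclideanSpace ℝ (Fin 3)) (σ σ' : ℤ → ℤ), IsHaggSeq σ ∧ IsHaggSeq σ' ∧
        (fun p => A₁ p + t₁) '' fccStacking 1 (Real.sqrt (2 / 3)) ⊆
          (fun p => L p + s₁) '' barlowStacking 1 (Real.sqrt (2 / 3)) σ ∧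
        (fun p => A₂ p + t₂) '' fccStacking 1 (Real.sqrt (2 / 3)) ⊆
          (fun p => L p + s₂) '' barlowStacking 1 (Real.sqrt (2 / 3)) σ')
    (hne : A₁ '' fccStacking 1 (Real.sqrt (2 / 3)) ≠ A₂ '' fccStacking 1 (Real.sqrt (2 / 3))) :
    ∃ ν : EuclideanSpace ℝ (Fin 3), ‖ν‖ = 1 ∧
      (∀ w ∈ fccSlots, ⟪A₁ w, ν⟫_ℝ = 0 ∨ ⟪A₁ w, ν⟫_ℝ = Real.sqrt (2 / 3) ∨ ⟪A₁ w, ν⟫_ℝ = -Real.sqrt (2 / 3)) ∧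
      A₂ '' fccStacking 1 (Real.sqrt (2 / 3)) = twinFrame A₁ ν '' fccStacking 1 (Real.sqrt (2 / 3)) ∧
      ((9 / 20 : ℝ) ≤ Real.sqrt 3 / 2 * Real.sqrt (1 - ⟪ν, EuclideanSpace.single (2 : Fin 3) (1 : ℝ)⟫_ℝ ^ 2) →
        TwoSlabLedgerAt (Real.sqrt 6 / 4 * Real.sqrt (1 - ⟪ν, EuclideanSpace.single (2 : Fin 3) (1 : ℝ)⟫_ℝ ^ 2))
          A₁ t₁ A₂ t₂) := by
  have hco0 := coaxial_translate A₁ A₂ t₁ t₂ 0 0 hco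
  have h1 : (fun p : EuclideanSpace ℝ (Fin 3) => A₁ p + 0) = (A₁ : EuclideanSpace ℝ (Fin 3) → EuclideanSpace ℝ (Fin 3)) :=
    funext fun p => add_zero _
  have h2 : (fun p : EuclideanSpace ℝ (Fin 3) => A₂ p + 0) = (A₂ : EuclideanSpace ℝ (Fin 3) → EuclideanSpace ℝ (Fin 3)) :=
    funext fun p => add_zero _
  rw [h1, h2] at hco0
  rcases eq_or_twin_of_coaxial A₁ A₂ hco0 with heq | ⟨ν, hν, hmenu, htwin⟩
  · exact absurd heq hne
  refine ⟨ν, hν, hmenu, htwin, fun htilt => ?_⟩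
  set e : EuclideanSpace ℝ (Fin 3) := EuclideanSpace.single (2 : Fin 3) (1 : ℝ) with he
  have hlt : ⟪ν, e⟫_ℝ ^ 2 < 1 := by
    by_contra hge
    push Not at hge
    have : Real.sqrt (1 - ⟪ν, e⟫_ℝ ^ 2) = 0 := Real.sqrt_eq_zero'.2 (by linarith)
    rw [this, mul_zero] at htilt
    norm_num at htilt
  obtain ⟨w, hw, hwν, hwe⟩ := exists_inPlane_slot_ge_sin A₁ hν hmenu hlt
  have hup : (9 / 20 : ℝ) ≤ ⟪A₁ w, e⟫_ℝ := htilt.trans hwe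
  set μ : EuclideanSpace ℝ (Fin 3) := A₁.symm ν with hμ
  have hμu : ‖μ‖ = 1 := by rw [hμ, LinearIsometryEquiv.norm_map, hν]
  have hμm : ∀ w ∈ fccSlots, ⟪w, μ⟫_ℝ = 0 ∨ ⟪w, μ⟫_ℝ = Real.sqrt (2 / 3) ∨ ⟪w, μ⟫_ℝ = -Real.sqrt (2 / 3) := by
    intro w' hw'
    rw [hμ, ← LinearIsometryEquiv.inner_map_map A₁, LinearIsometryEquiv.apply_symm_apply]
    exact hmenu w' hw'
  have htw : twinFrame A₁ ν = wordFrame A₁ [μ] := by rw [twinFrame_eq_reflection_trans A₁ hν]; rfl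
  have hA₂ : A₂ '' fccStacking 1 (Real.sqrt (2 / 3)) = (wordFrame A₁ [μ]) '' fccStacking 1 (Real.sqrt (2 / 3)) := by
    rw [htwin, htw]
  have hplane : ⟪w, μ⟫_ℝ = 0 := by
    rw [hμ, ← LinearIsometryEquiv.inner_map_map A₁, LinearIsometryEquiv.apply_symm_apply]; exact hwν
  have h := twoSlabLedger_twin_inPlane_wide_of_inner_ge hs₀ hcert hfar A₁ t₁ A₂ t₂ ⟨hμu, hμm⟩ hA₂ hw hplane hup
  exact twoSlabLedgerAt_mono (sqrt6_div_four_mul_le hwe) h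

open scoped Classical in
/-- **Lane F's stub inequality for twin pairs with `(√3/2) sin θ ≥ 9/20`, arbitrary fillings** (wide tilt): charge
`½·√(1 − ⟪ν,e₃⟫²)`, modulo `ExactOnly`(C12-55) and `StarPairFar`. -/
theorem coaxialTwin_twoSlabLedger_half_sin_wide
    {s₀ : EuclideanSpace ℝ (Fin 3)} (hs₀ : s₀ ∈ fccSlots)
    (hcert : ExactOnly 0 (fccSlots.filter fun w => 0 < ⟪w, s₀⟫_ℝ)) (hfar : StarPairFar)
    (A₁ : EuclideanSpace ℝ (Fin 3) ≃ₗᵢ[ℝ] EuclideanSpace ℝ (Fin 3)) (t₁ : EuclideanSpace ℝ (Fin 3))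
    (A₂ : EuclideanSpace ℝ (Fin 3) ≃ₗᵢ[ℝ] EuclideanSpace ℝ (Fin 3)) (t₂ : EuclideanSpace ℝ (Fin 3))
    (hco : ∃ (L : EuclideanSpace ℝ (Fin 3) ≃ₗᵢ[ℝ] EuclideanSpace ℝ (Fin 3))
        (s₁ s₂ : EuclideanSpace ℝ (Fin 3)) (σ σ' : ℤ → ℤ), IsHaggSeq σ ∧ IsHaggSeq σ' ∧
        (fun p => A₁ p + t₁) '' fccStacking 1 (Real.sqrt (2 / 3)) ⊆
          (fun p => L p + s₁) '' barlowStacking 1 (Real.sqrt (2 / 3)) σ ∧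
        (fun p => A₂ p + t₂) '' fccStacking 1 (Real.sqrt (2 / 3)) ⊆
          (fun p => L p + s₂) '' barlowStacking 1 (Real.sqrt (2 / 3)) σ')
    (hne : A₁ '' fccStacking 1 (Real.sqrt (2 / 3)) ≠ A₂ '' fccStacking 1 (Real.sqrt (2 / 3))) :
    ∃ ν : EuclideanSpace ℝ (Fin 3), ‖ν‖ = 1 ∧
      (∀ w ∈ fccSlots, ⟪A₁ w, ν⟫_ℝ = 0 ∨ ⟪A₁ w, ν⟫_ℝ = Real.sqrt (2 / 3) ∨ ⟪A₁ w, ν⟫_ℝ = -Real.sqrt (2 / 3)) ∧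
      A₂ '' fccStacking 1 (Real.sqrt (2 / 3)) = twinFrame A₁ ν '' fccStacking 1 (Real.sqrt (2 / 3)) ∧
      ((9 / 20 : ℝ) ≤ Real.sqrt 3 / 2 * Real.sqrt (1 - ⟪ν, EuclideanSpace.single (2 : Fin 3) (1 : ℝ)⟫_ℝ ^ 2) →
        TwoSlabLedgerAt (1 / 2 * Real.sqrt (1 - ⟪ν, EuclideanSpace.single (2 : Fin 3) (1 : ℝ)⟫_ℝ ^ 2)) A₁ t₁ A₂ t₂) := by
  obtain ⟨ν, hν, hmenu, htwin, hcell⟩ := coaxialTwin_twoSlabLedger_sharp_wide hs₀ hcert hfar A₁ t₁ A₂ t₂ hco hne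
  refine ⟨ν, hν, hmenu, htwin, fun htilt => twoSlabLedgerAt_mono ?_ (hcell htilt)⟩
  have hsq0 : 0 ≤ Real.sqrt (1 - ⟪ν, EuclideanSpace.single (2 : Fin 3) (1 : ℝ)⟫_ℝ ^ 2) := Real.sqrt_nonneg _
  have h6 : (2 : ℝ) ≤ Real.sqrt 6 := by
    rw [show (2 : ℝ) = Real.sqrt (2 ^ 2) by rw [Real.sqrt_sq (by norm_num)]]
    exact Real.sqrt_le_sqrt (by norm_num)
  nlinarith

end Summit.Ventures.Crystal3D.Theorems

end
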